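import Literature.AlgebraicGeometry.AbelianSchemes.DualPairHatTransitions
import Literature.AlgebraicGeometry.AbelianSchemes.AbelianSchemeDualTransportOfBaseChangeFunctorial
import HarnessLib

/-!
# Zariski gluing of dual pairs, FILE H part 2: the transition isomorphisms of the chart duals satisfy the COCYCLE
# IDENTITY (dual pairs are unique up to a UNIQUE isomorphism), so the hats glue unconditionally

Layer `Literature/AlgebraicGeometry/AbelianSchemes`, namespace `Literature.AlgebraicGeometry.AbelianSchemes.AbelianSchemeOver`.
Cell hodgecm-mathlib (D-0151), FLOOR 0 programme P1, sub-line `Cruxes/HDel/Lines/F3DualAbelianScheme.lean` (17224f58), stub (Z)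
`stub_F3Z` «`DualPair`s GLUE ALONG A ZARISKI COVER OF THE BASE», road (Z3) FILE H of the SOCKETS memo
`B-provers/B-p06/g14/F3/SOCKETS-F3Z-Z1-Z3.B-p06g14.md` (b2336dc7), step (H4) — the sequel of ★ FILE H part 1
`DualPairHatTransitions` (B-p06 (g14)), which leaves the cocycle identity `hcoc` of the hat transitions
`θᵢⱼ = hatTransition i j : Âᵢ|_{V(i,j)} → Âⱼ|_{V(j,i)}` as the ONE hypothesis of `hatCocycleDatum` / `gluedHat`.
THEOREMS ONLY (no definition, no structure, no instance, no notation, no named fact, no `sorry`).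

ROAD — FUNCTORIALITY OF THE DUAL TRANSPORT, not point-rigidity ([MilneAV2008, I §8 pp. 36–37]: «there is a UNIQUE regular
map `α : T → A^∨` such that `(1 × α)^*𝒫 ≈ ℒ`», whence ★ `hatTransportOfBaseChange_trans` `Ĝ_{h' ≫ h} = Ĝ_{h'} ≫ Ĝ_h`,
★ `hatTransportOfBaseChange_baseChange` `Ĝ_{pr} = pr`, ★ `hatTransportOfBaseChange_congr`, and B-p06's
`hatTransportOfBaseChange_refl_eq_id` `Ĝ_{(𝟙,𝟙)} = 𝟙`; no geometric points, no field-level rigidity hypothesis, no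
reducedness):

* §1 (generic, any relative cocycle setting `(D, Z, z, θ)` of ★ `Morphisms/GlueDataRelative`) the relative triple overlap
  `Tᵢ(j,k) = (Zᵢ ×_{Uᵢ} V(i,j)) ×_{Zᵢ} (Zᵢ ×_{Uᵢ} V(i,k))` and the ITERATED base change
  `Wᵢ(j,k) = (Zᵢ ×_{Uᵢ} V(i,j)) ×_{V(i,j)} (V(i,j) ×_{Uᵢ} V(i,k))` are two pull-backs of the same cospan
  (`isPullback_snd_fst`; ★ `isPullback_relativeToBase`), so for ANY isomorphisms `ω` between them compatible with the two
  projections the lifted transition map is a conjugate, `relativeT' i j k = ω ≫ m ≫ ω'⁻¹`, of every `m : Wᵢ(j,k) → Wⱼ(k,i)`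
  with the right `Zⱼ`-component and lying over `D.t' i j k` (`relativeT'_eq_conj_of_iso`, ★ `relativeT'_unique`); hence
  **`relativeT'_cocycle_of_transitions`**: a family `m i j k` of such maps with `m i j k ≫ m j k i ≫ m k i j = 𝟙` gives the
  cocycle identity of the `relativeT'` (the pattern of ★ `AbelianSchemeOverGlueDataTripleCocycle` §1–§3, made generic);
* §2 for the hats: on the base triple overlap `V(i,j) ×_{Uᵢ} V(i,k)` the twice-restricted chart families
  `Aᵢ|_{V(i,j)}|` and `Aⱼ|_{V(j,k)}|` are related by a transition of GROUP schemes `G` over `D.t' i j k` (squares into `Aⱼ`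
  cancel, ★ `exists_comp_eq_of_comp` / `isBaseChangeVia_of_comp`), and the dual transport `Ĝ` of the twice-restricted
  chart duals along it (★ `hatTransportOfBaseChange`) has `Zⱼ`-component `(pr ≫ θᵢⱼ) ≫ pr` — BOTH are dual transports into
  the chart dual `Dⱼ` (`hatTransport₃_fst_fst`) — and lies over `D.t' i j k`;
* §3 **`hatTransport₃_cocycle`**: `Ĝ₁ ≫ Ĝ₂ ≫ Ĝ₃` is the dual transport along the composite square, whose base map is
  `t' t' t' = 𝟙` (Mathlib `Scheme.GlueData.cocycle`) and whose `A`-map `G₁ G₂ G₃` is `𝟙` (★ `comp_eq_unique` against the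
  projection to `A`), hence `𝟙`;
* §4 **`hatTransition_cocycle`** — the `hcoc` hypothesis of ★ `hatCocycleDatum` / `gluedHat` DISCHARGED, in its exact binder
  shape; **`exists_gluedHat`** — the head for the FILE P consumer: an abelian scheme `Â⁰ → S` with cartesian group-scheme
  charts `χᵢ : Âᵢ → Â⁰` over `Uᵢ → S` (transport along Mathlib's `𝒰.fromGlued : 𝒰.gluedCover.glued ≅ S`) satisfying the
  glue condition `θᵢⱼ ≫ pr ≫ χⱼ = pr ≫ χᵢ` over `V(i,j)`.

[BoschLutkebohmertRaynaud1990, §8.1] (the rigidified Picard functor is a sheaf) / [MumfordFogartyKirwan1994, Ch. 6 §1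
Cor. 6.8] over a base covered by opens: the chartwise duals `(Âᵢ, 𝒫ᵢ)` glue because their transition isomorphisms are
UNIQUE ([MilneAV2008, I §8]), which is what makes the cocycle condition automatic.  HC_CM is proved only modulo the 7 printed
citations until rung 0 closes; this file discharges none of them (count-neutral capital on the (Z) road of F-3).

Mathlib searched (pin): `Scheme.Cover.gluedCover` (`@[simps]`: `J/U/V/f/t/t'` by `rfl`), `Scheme.GlueData.cocycle`,
`Scheme.GlueData.t_fac`, `Scheme.GlueData.glue_condition`, `Scheme.Cover.ι_fromGlued`, `IsPullback.isoIsPullback(_hom_fst/_hom_snd)`,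
`pullback_fst_iso_of_right_iso`; tree ★ `Morphisms/GlueDataRelative` (`relativeT'`, `relativeT'_unique`, `relativeToBase_fst/_snd`,
`isPullback_relativeToBase`, `relativeGlueData_t/_f`), ★ `AbelianSchemeOverGlueData` (`CocycleDatum.total/.abelianScheme`).

## References
* [MilneAV2008] J. S. Milne, *Abelian Varieties* (v2.00, 2008), I §8 pp. 36–37 (the dual pair: unique classifying map).
* [MumfordFogartyKirwan1994] D. Mumford, J. Fogarty, F. Kirwan, *Geometric Invariant Theory*, 3rd ed. (1994), Ch. 6 §1
  Cor. 6.8 (p. 118) («`(X ×_S T)^ = X̂ ×_S T`»); Ch. 7 §2 Def. 7.2, Def. 7.3 (p. 129), remark after Def. 7.5 (p. 130).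
* [BoschLutkebohmertRaynaud1990] S. Bosch, W. Lütkebohmert, M. Raynaud, *Néron Models* (1990), §8.1 Prop. 4 (pp. 204–205), Def. 5 (p. 205).
* [StacksProject] The Stacks Project, Tag 01LH (relative glueing), Tag 01JA (glueing schemes).
* [GortzWedhorn2020] U. Görtz, T. Wedhorn, *Algebraic Geometry I*, 2nd ed. (2020), Prop. 4.16 (p. 101), Section (4.8) Lemma 4.28.
-/

universe u

open CategoryTheory CategoryTheory.Limits AlgebraicGeometry MonoidalCategory
open Literature.AlgebraicGeometry.Morphisms

noncomputable section

namespace Literature.AlgebraicGeometry.AbelianSchemes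

namespace AbelianSchemeOver

/-! ### §1 Generic: relative triple overlaps vs iterated base change; the cocycle identity from a family of transitions -/

section Generic

variable (D : Scheme.GlueData.{u}) (Z : D.J → Scheme.{u}) (z : ∀ i, Z i ⟶ D.U i)
  (θ : ∀ i j, pullback (z i) (D.f i j) ⟶ pullback (z j) (D.f j i))
  (hθ : ∀ i j, θ i j ≫ pullback.snd (z j) (D.f j i) = pullback.snd (z i) (D.f i j) ≫ D.t i j)

/-- The ITERATED base change `Wᵢ(j,k) = (Zᵢ ×_{Uᵢ} V(i,j)) ×_{V(i,j)} (V(i,j) ×_{Uᵢ} V(i,k))` is cartesian over `zᵢ : Zᵢ → Uᵢ`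
along `V(i,j) ×_{Uᵢ} V(i,k) → V(i,j) → Uᵢ` (two chosen pull-back squares pasted) — the same cospan as the relative triple
overlap of ★ `isPullback_relativeToBase`. [cite: GortzWedhorn2020, Section (4.8) Lemma 4.28] [cite: StacksProject, Tag 01LH] -/
theorem isPullback_snd_fst (i j k : D.J) :
    IsPullback
      (pullback.fst (pullback.snd (z i) (D.f i j)) (pullback.fst (D.f i j) (D.f i k)) ≫ pullback.fst (z i) (D.f i j))
      (pullback.snd (pullback.snd (z i) (D.f i j)) (pullback.fst (D.f i j) (D.f i k))) (z i)
      (pullback.fst (D.f i j) (D.f i k) ≫ D.f i j) :=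
  (IsPullback.of_hasPullback (pullback.snd (z i) (D.f i j)) (pullback.fst (D.f i j) (D.f i k))).paste_horiz
    (IsPullback.of_hasPullback (z i) (D.f i j))

/-- **The lifted transition map is a conjugate of any transition of the iterated base changes**: for isomorphisms
`ω : Tᵢ(j,k) ≅ Wᵢ(j,k)`, `ω' : Tⱼ(k,i) ≅ Wⱼ(k,i)` compatible with the projections to `Zᵢ ×_{Uᵢ} V(i,j)` (resp.
`Zⱼ ×_{Uⱼ} V(j,k)`) and to the base triple overlaps (★ `relativeToBase`), and ANY `m : Wᵢ(j,k) → Wⱼ(k,i)` whose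
`Zⱼ`-component is `(pr ≫ θᵢⱼ) ≫ pr` and which lies over `D.t' i j k`, one has `relativeT' i j k = ω ≫ m ≫ ω'⁻¹`
(★ `relativeT'_unique`: both sides lie over `θᵢⱼ`, i.e. have the same `Zⱼ`- and `V(j,i)`-components; Mathlib
`Scheme.GlueData.t_fac`).  The pattern of ★ `PolarizedAbelianSchemeWithLevel.relativeT'_eq_conj`, made generic.
[cite: StacksProject, Tag 01LH] [cite: GortzWedhorn2020, Section (3.5) Definition 3.9] -/
theorem relativeT'_eq_conj_of_iso (i j k : D.J)
    (ω : pullback (pullback.fst (z i) (D.f i j)) (pullback.fst (z i) (D.f i k)) ≅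
      pullback (pullback.snd (z i) (D.f i j)) (pullback.fst (D.f i j) (D.f i k)))
    (hω₁ : ω.hom ≫ pullback.fst _ _ ≫ pullback.fst (z i) (D.f i j) = pullback.fst _ _ ≫ pullback.fst (z i) (D.f i j))
    (hω₂ : ω.hom ≫ pullback.snd _ _ = relativeToBase D Z z i j k)
    (ω' : pullback (pullback.fst (z j) (D.f j k)) (pullback.fst (z j) (D.f j i)) ≅
      pullback (pullback.snd (z j) (D.f j k)) (pullback.fst (D.f j k) (D.f j i)))
    (hω'₁ : ω'.hom ≫ pullback.fst _ _ ≫ pullback.fst (z j) (D.f j k) = pullback.fst _ _ ≫ pullback.fst (z j) (D.f j k))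
    (hω'₂ : ω'.hom ≫ pullback.snd _ _ = relativeToBase D Z z j k i)
    (m : pullback (pullback.snd (z i) (D.f i j)) (pullback.fst (D.f i j) (D.f i k)) ⟶
      pullback (pullback.snd (z j) (D.f j k)) (pullback.fst (D.f j k) (D.f j i)))
    (hmG : m ≫ pullback.fst _ _ ≫ pullback.fst (z j) (D.f j k) =
      (pullback.fst _ _ ≫ θ i j) ≫ pullback.fst (z j) (D.f j i))
    (hmπ : m ≫ pullback.snd _ _ = pullback.snd _ _ ≫ D.t' i j k) :
    relativeT' D Z z θ hθ i j k = ω.hom ≫ m ≫ ω'.inv := by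
  symm
  refine relativeT'_unique D Z z θ hθ i j k _ ?_
  -- derived component identities of `ω` and `ω'⁻¹`
  have hωfst : ω.hom ≫ pullback.fst _ _ =
      pullback.fst (pullback.fst (z i) (D.f i j)) (pullback.fst (z i) (D.f i k)) := by
    apply pullback.hom_ext
    · rw [Category.assoc]
      exact hω₁
    · rw [Category.assoc, pullback.condition, ← Category.assoc, hω₂, relativeToBase_fst]
  have hω'inv₁ : ω'.inv ≫ pullback.fst _ _ ≫ pullback.fst (z j) (D.f j k) =
      pullback.fst _ _ ≫ pullback.fst (z j) (D.f j k) := by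
    rw [Iso.inv_comp_eq, hω'₁]
  have hω'inv₂ : ω'.inv ≫ relativeToBase D Z z j k i = pullback.snd _ _ := by
    rw [Iso.inv_comp_eq, hω'₂]
  -- `pullback.snd` of `Tⱼ(k,i)` into `Zⱼ ×_{Uⱼ} V(j,i)`: its `Zⱼ`-component is `pr ≫ pr`
  have hT : pullback.snd (pullback.fst (z j) (D.f j k)) (pullback.fst (z j) (D.f j i)) ≫
      pullback.fst (z j) (D.f j i) =
      pullback.fst (pullback.fst (z j) (D.f j k)) (pullback.fst (z j) (D.f j i)) ≫
        pullback.fst (z j) (D.f j k) := pullback.condition.symm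
  apply pullback.hom_ext
  · -- `Zⱼ`-components
    have l : ((ω.hom ≫ m ≫ ω'.inv) ≫ pullback.snd _ _) ≫ pullback.fst (z j) (D.f j i) =
        ω.hom ≫ m ≫ pullback.fst _ _ ≫ pullback.fst (z j) (D.f j k) := by
      rw [Category.assoc, hT, Category.assoc, Category.assoc, hω'inv₁]
    refine l.trans ((congrArg (ω.hom ≫ ·) hmG).trans ?_)
    rw [← Category.assoc, ← Category.assoc, hωfst]
  · -- `V(j,i)`-components: through the base triple overlaps and `t_fac`
    have hsnd : pullback.snd (pullback.fst (z j) (D.f j k)) (pullback.fst (z j) (D.f j i)) ≫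
        pullback.snd (z j) (D.f j i) =
        relativeToBase D Z z j k i ≫ pullback.snd (D.f j k) (D.f j i) :=
      (relativeToBase_snd D Z z j k i).symm
    have hfst : pullback.fst (pullback.fst (z i) (D.f i j)) (pullback.fst (z i) (D.f i k)) ≫
        pullback.snd (z i) (D.f i j) =
        relativeToBase D Z z i j k ≫ pullback.fst (D.f i j) (D.f i k) :=
      (relativeToBase_fst D Z z i j k).symm
    rw [Category.assoc, Category.assoc, Category.assoc, hsnd, ← Category.assoc ω'.inv, hω'inv₂, ← Category.assoc m, hmπ,
      Category.assoc, D.t_fac, ← Category.assoc ω.hom, hω₂, Category.assoc, hθ]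
    exact ((congrArg (· ≫ D.t i j) hfst).symm).trans (Category.assoc _ _ _)

/-- **THE COCYCLE IDENTITY FROM A FAMILY OF TRANSITIONS of the iterated base changes**: if maps
`m i j k : Wᵢ(j,k) → Wⱼ(k,i)` with `Zⱼ`-component `(pr ≫ θᵢⱼ) ≫ pr`, lying over `D.t' i j k`, satisfy
`m i j k ≫ m j k i ≫ m k i j = 𝟙`, then the lifted transition maps of ★ `GlueDataRelative` satisfy the cocycle identity
`relativeT' i j k ≫ relativeT' j k i ≫ relativeT' k i j = 𝟙` (conjugate by the canonical `Tᵢ(j,k) ≅ Wᵢ(j,k)`, Mathlib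
`IsPullback.isoIsPullback` of ★ `isPullback_relativeToBase` and `isPullback_snd_fst`). [cite: StacksProject, Tag 01LH]
[cite: GortzWedhorn2020, Section (3.5) Definition 3.9 and Section (4.8) Lemma 4.28] -/
theorem relativeT'_cocycle_of_transitions
    (m : ∀ i j k, pullback (pullback.snd (z i) (D.f i j)) (pullback.fst (D.f i j) (D.f i k)) ⟶
      pullback (pullback.snd (z j) (D.f j k)) (pullback.fst (D.f j k) (D.f j i)))
    (hmG : ∀ i j k, m i j k ≫ pullback.fst _ _ ≫ pullback.fst (z j) (D.f j k) =
      (pullback.fst _ _ ≫ θ i j) ≫ pullback.fst (z j) (D.f j i))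
    (hmπ : ∀ i j k, m i j k ≫ pullback.snd _ _ = pullback.snd _ _ ≫ D.t' i j k)
    (hm : ∀ i j k, m i j k ≫ m j k i ≫ m k i j = 𝟙 _) (i j k : D.J) :
    relativeT' D Z z θ hθ i j k ≫ relativeT' D Z z θ hθ j k i ≫ relativeT' D Z z θ hθ k i j = 𝟙 _ := by
  -- the canonical isomorphisms `ω_{abc} : T_a(b,c) ≅ W_a(b,c)` and their two defining component identities
  have e := fun a b c => relativeT'_eq_conj_of_iso D Z z θ hθ a b c
    ((isPullback_relativeToBase D Z z a b c).isoIsPullback _ _ (isPullback_snd_fst D Z z a b c))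
    ((isPullback_relativeToBase D Z z a b c).isoIsPullback_hom_fst _ _ (isPullback_snd_fst D Z z a b c))
    ((isPullback_relativeToBase D Z z a b c).isoIsPullback_hom_snd _ _ (isPullback_snd_fst D Z z a b c))
    ((isPullback_relativeToBase D Z z b c a).isoIsPullback _ _ (isPullback_snd_fst D Z z b c a))
    ((isPullback_relativeToBase D Z z b c a).isoIsPullback_hom_fst _ _ (isPullback_snd_fst D Z z b c a))
    ((isPullback_relativeToBase D Z z b c a).isoIsPullback_hom_snd _ _ (isPullback_snd_fst D Z z b c a))
    (m a b c) (hmG a b c) (hmπ a b c)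
  rw [e i j k, e j k i, e k i j]
  simp only [Category.assoc, Iso.inv_hom_id_assoc]
  rw [reassoc_of% (hm i j k), Iso.hom_inv_id]

end Generic

/-! ### §2 Hats: the transition of the twice-restricted chart families and duals over the base triple overlaps -/

section Hat

variable {S : Scheme.{u}} (A : AbelianSchemeOver S) (𝒰 : Scheme.OpenCover.{u} S)

/-- `Aᵢ|_{V(i,j)}|_{V(i,j) ×_{Uᵢ} V(i,k)}` is a base change of the chart family `Aⱼ = A ×_S Uⱼ` along
`t' i j k ≫ (V(j,k) ×_{Uⱼ} V(j,i) → V(j,k) → Uⱼ)` via `(pr ≫ overlapTransition i j) ≫ pr` (the chosen base-change square,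
B-p06's `overlapTransition_isBaseChangeVia`, the chosen square into `Aⱼ`, composed — ★ `IsBaseChangeVia.trans` — and the
base maps aligned by Mathlib `gluedCoverT'_fst_fst` / `pullbackSymmetry_hom_comp_fst`).
[cite: MumfordFogartyKirwan1994, Ch. 7 §2 Definition 7.2 (p. 129)] [cite: StacksProject, Tag 01JA] -/
theorem overlapFamily₃_isBaseChangeVia_chart (i j k : 𝒰.I₀) :
    ((A.overlapFamily 𝒰 i j).baseChange
        (pullback.fst (pullback.fst (𝒰.f i) (𝒰.f j)) (pullback.fst (𝒰.f i) (𝒰.f k)))).IsBaseChangeVia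
      (A.baseChange (𝒰.f j))
      (𝒰.gluedCoverT' i j k ≫ pullback.fst (pullback.fst (𝒰.f j) (𝒰.f k)) (pullback.fst (𝒰.f j) (𝒰.f i)) ≫
        pullback.fst (𝒰.f j) (𝒰.f k))
      ((pullback.fst (A.overlapFamily 𝒰 i j).X.hom
          (pullback.fst (pullback.fst (𝒰.f i) (𝒰.f j)) (pullback.fst (𝒰.f i) (𝒰.f k))) ≫
        A.overlapTransition 𝒰 i j) ≫
        pullback.fst (A.baseChange (𝒰.f j)).X.hom (pullback.fst (𝒰.f j) (𝒰.f i))) := by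
  have h := ((((A.overlapFamily 𝒰 i j).baseChange_isBaseChangeVia
    (pullback.fst (pullback.fst (𝒰.f i) (𝒰.f j)) (pullback.fst (𝒰.f i) (𝒰.f k)))).trans
      (A.overlapTransition_isBaseChangeVia 𝒰 i j)).trans
        ((A.baseChange (𝒰.f j)).baseChange_isBaseChangeVia (pullback.fst (𝒰.f j) (𝒰.f i))))
  refine IsBaseChangeVia.congr_base ?_ h
  rw [Category.assoc, pullbackSymmetry_hom_comp_fst, Scheme.Cover.gluedCoverT'_fst_fst]

/-- `Aⱼ|_{V(j,k)}|_{V(j,k) ×_{Uⱼ} V(j,i)}` is a base change of `Aⱼ` along `V(j,k) ×_{Uⱼ} V(j,i) → V(j,k) → Uⱼ` via the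
projections (two chosen squares). [cite: MumfordFogartyKirwan1994, Ch. 7 §2 Definition 7.2 (p. 129)] -/
theorem overlapFamily₃_isBaseChangeVia_chart' (i j k : 𝒰.I₀) :
    ((A.overlapFamily 𝒰 j k).baseChange
        (pullback.fst (pullback.fst (𝒰.f j) (𝒰.f k)) (pullback.fst (𝒰.f j) (𝒰.f i)))).IsBaseChangeVia
      (A.baseChange (𝒰.f j))
      (pullback.fst (pullback.fst (𝒰.f j) (𝒰.f k)) (pullback.fst (𝒰.f j) (𝒰.f i)) ≫ pullback.fst (𝒰.f j) (𝒰.f k))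
      (pullback.fst (A.overlapFamily 𝒰 j k).X.hom
          (pullback.fst (pullback.fst (𝒰.f j) (𝒰.f k)) (pullback.fst (𝒰.f j) (𝒰.f i))) ≫
        pullback.fst (A.baseChange (𝒰.f j)).X.hom (pullback.fst (𝒰.f j) (𝒰.f k))) :=
  ((A.overlapFamily 𝒰 j k).baseChange_isBaseChangeVia
    (pullback.fst (pullback.fst (𝒰.f j) (𝒰.f k)) (pullback.fst (𝒰.f j) (𝒰.f i)))).trans
      ((A.baseChange (𝒰.f j)).baseChange_isBaseChangeVia (pullback.fst (𝒰.f j) (𝒰.f k)))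

/-- **The transition of GROUP schemes on the base triple overlap** `G : Aᵢ|_{V(i,j)}| → Aⱼ|_{V(j,k)}|` covering
Mathlib's `t' i j k : V(i,j) ×_{Uᵢ} V(i,k) ⥲ V(j,k) ×_{Uⱼ} V(j,i)` (squares into `Aⱼ` cancel: ★ `exists_comp_eq_of_comp`,
★ `isBaseChangeVia_of_comp`), with `Aⱼ`-component `(pr ≫ overlapTransition i j) ≫ pr`. [cite: GortzWedhorn2020, Prop. 4.16 (p. 101)]
[cite: MumfordFogartyKirwan1994, Ch. 7 §2 Definition 7.2 (p. 129)] -/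
theorem exists_overlapTransition₃ (i j k : 𝒰.I₀) :
    ∃ G : ((A.overlapFamily 𝒰 i j).baseChange
        (pullback.fst (pullback.fst (𝒰.f i) (𝒰.f j)) (pullback.fst (𝒰.f i) (𝒰.f k)))).X.left ⟶
      ((A.overlapFamily 𝒰 j k).baseChange
        (pullback.fst (pullback.fst (𝒰.f j) (𝒰.f k)) (pullback.fst (𝒰.f j) (𝒰.f i)))).X.left,
      ((A.overlapFamily 𝒰 i j).baseChange
          (pullback.fst (pullback.fst (𝒰.f i) (𝒰.f j)) (pullback.fst (𝒰.f i) (𝒰.f k)))).IsBaseChangeVia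
        ((A.overlapFamily 𝒰 j k).baseChange
          (pullback.fst (pullback.fst (𝒰.f j) (𝒰.f k)) (pullback.fst (𝒰.f j) (𝒰.f i))))
        (𝒰.gluedCoverT' i j k) G ∧
      G ≫ pullback.fst (A.overlapFamily 𝒰 j k).X.hom
            (pullback.fst (pullback.fst (𝒰.f j) (𝒰.f k)) (pullback.fst (𝒰.f j) (𝒰.f i))) ≫
          pullback.fst (A.baseChange (𝒰.f j)).X.hom (pullback.fst (𝒰.f j) (𝒰.f k)) =
        (pullback.fst (A.overlapFamily 𝒰 i j).X.hom
            (pullback.fst (pullback.fst (𝒰.f i) (𝒰.f j)) (pullback.fst (𝒰.f i) (𝒰.f k))) ≫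
          A.overlapTransition 𝒰 i j) ≫
          pullback.fst (A.baseChange (𝒰.f j)).X.hom (pullback.fst (𝒰.f j) (𝒰.f i)) := by
  obtain ⟨G, hG, hπ⟩ := IsBaseChangeVia.exists_comp_eq_of_comp (A.overlapFamily₃_isBaseChangeVia_chart 𝒰 i j k)
    (A.overlapFamily₃_isBaseChangeVia_chart' 𝒰 i j k)
  exact ⟨G, isBaseChangeVia_of_comp (A.overlapFamily₃_isBaseChangeVia_chart 𝒰 i j k)
    (A.overlapFamily₃_isBaseChangeVia_chart' 𝒰 i j k) G hG hπ, hG⟩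

/-- A transition `G` on the base triple overlap with `Aⱼ`-component `(pr ≫ overlapTransition i j) ≫ pr` COMMUTES WITH THE
PROJECTIONS TO `A` (B-p06's `overlapTransition_comp_fst_fst`). [cite: MumfordFogartyKirwan1994, Ch. 7 §2 Definition 7.2 (p. 129)] -/
theorem overlapTransition₃_comp_toA (i j k : 𝒰.I₀)
    (G : ((A.overlapFamily 𝒰 i j).baseChange
        (pullback.fst (pullback.fst (𝒰.f i) (𝒰.f j)) (pullback.fst (𝒰.f i) (𝒰.f k)))).X.left ⟶
      ((A.overlapFamily 𝒰 j k).baseChange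
        (pullback.fst (pullback.fst (𝒰.f j) (𝒰.f k)) (pullback.fst (𝒰.f j) (𝒰.f i)))).X.left)
    (hGfst : G ≫ pullback.fst (A.overlapFamily 𝒰 j k).X.hom
            (pullback.fst (pullback.fst (𝒰.f j) (𝒰.f k)) (pullback.fst (𝒰.f j) (𝒰.f i))) ≫
          pullback.fst (A.baseChange (𝒰.f j)).X.hom (pullback.fst (𝒰.f j) (𝒰.f k)) =
      (pullback.fst (A.overlapFamily 𝒰 i j).X.hom
            (pullback.fst (pullback.fst (𝒰.f i) (𝒰.f j)) (pullback.fst (𝒰.f i) (𝒰.f k))) ≫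
          A.overlapTransition 𝒰 i j) ≫
        pullback.fst (A.baseChange (𝒰.f j)).X.hom (pullback.fst (𝒰.f j) (𝒰.f i))) :
    G ≫ pullback.fst (A.overlapFamily 𝒰 j k).X.hom
            (pullback.fst (pullback.fst (𝒰.f j) (𝒰.f k)) (pullback.fst (𝒰.f j) (𝒰.f i))) ≫
          pullback.fst (A.baseChange (𝒰.f j)).X.hom (pullback.fst (𝒰.f j) (𝒰.f k)) ≫ pullback.fst A.X.hom (𝒰.f j) =
      pullback.fst (A.overlapFamily 𝒰 i j).X.hom
          (pullback.fst (pullback.fst (𝒰.f i) (𝒰.f j)) (pullback.fst (𝒰.f i) (𝒰.f k))) ≫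
        pullback.fst (A.baseChange (𝒰.f i)).X.hom (pullback.fst (𝒰.f i) (𝒰.f j)) ≫ pullback.fst A.X.hom (𝒰.f i) :=
  -- term-mode reassociation (the total spaces of base changes are `pullback`s only up to unfolding)
  (congrArg (G ≫ ·) (Category.assoc _ _ _).symm).trans ((Category.assoc _ _ _).symm.trans
    ((congrArg (· ≫ pullback.fst A.X.hom (𝒰.f j)) hGfst).trans ((Category.assoc _ _ _).trans
      ((Category.assoc _ _ _).trans (congrArg (pullback.fst (A.overlapFamily 𝒰 i j).X.hom
        (pullback.fst (pullback.fst (𝒰.f i) (𝒰.f j)) (pullback.fst (𝒰.f i) (𝒰.f k))) ≫ ·)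
          (A.overlapTransition_comp_fst_fst 𝒰 i j))))))

variable [IsLocallyNoetherian S] (D : ∀ i, (A.baseChange (𝒰.f i)).DualPair)

omit [IsLocallyNoetherian S] in
/-- **The dual transport along `G` has `Âⱼ`-component `(pr ≫ θᵢⱼ) ≫ pr`** — the `hmG` input of §1 for the hats: BOTH sides
are dual transports of the twice-restricted chart dual `Dᵢ|_{V(i,j)}|` into the chart dual `Dⱼ` (the projections are the dual
transports of the chosen squares, ★ `hatTransportOfBaseChange_baseChange`; `θᵢⱼ` is one by definition; composites by ★
`hatTransportOfBaseChange_trans`), along the same square into `Aⱼ` (★ `hatTransportOfBaseChange_congr`).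
[cite: MilneAV2008, I §8 pp. 36–37] [cite: MumfordFogartyKirwan1994, Ch. 6 §1 Cor. 6.8 (p. 118) and Ch. 7 §2 remark after Definition 7.5 (p. 130)] -/
theorem hatTransport₃_fst_fst (i j k : 𝒰.I₀)
    (G : ((A.overlapFamily 𝒰 i j).baseChange
        (pullback.fst (pullback.fst (𝒰.f i) (𝒰.f j)) (pullback.fst (𝒰.f i) (𝒰.f k)))).X.left ⟶
      ((A.overlapFamily 𝒰 j k).baseChange
        (pullback.fst (pullback.fst (𝒰.f j) (𝒰.f k)) (pullback.fst (𝒰.f j) (𝒰.f i)))).X.left)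
    (hG : ((A.overlapFamily 𝒰 i j).baseChange
        (pullback.fst (pullback.fst (𝒰.f i) (𝒰.f j)) (pullback.fst (𝒰.f i) (𝒰.f k)))).IsBaseChangeVia
      ((A.overlapFamily 𝒰 j k).baseChange
        (pullback.fst (pullback.fst (𝒰.f j) (𝒰.f k)) (pullback.fst (𝒰.f j) (𝒰.f i))))
      (𝒰.gluedCoverT' i j k) G)
    (hGfst : G ≫ pullback.fst (A.overlapFamily 𝒰 j k).X.hom
            (pullback.fst (pullback.fst (𝒰.f j) (𝒰.f k)) (pullback.fst (𝒰.f j) (𝒰.f i))) ≫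
          pullback.fst (A.baseChange (𝒰.f j)).X.hom (pullback.fst (𝒰.f j) (𝒰.f k)) =
      (pullback.fst (A.overlapFamily 𝒰 i j).X.hom
            (pullback.fst (pullback.fst (𝒰.f i) (𝒰.f j)) (pullback.fst (𝒰.f i) (𝒰.f k))) ≫
          A.overlapTransition 𝒰 i j) ≫
        pullback.fst (A.baseChange (𝒰.f j)).X.hom (pullback.fst (𝒰.f j) (𝒰.f i))) :
    DualPair.hatTransportOfBaseChange
        ((A.overlapDual 𝒰 D j k).baseChange
          (pullback.fst (pullback.fst (𝒰.f j) (𝒰.f k)) (pullback.fst (𝒰.f j) (𝒰.f i))))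
        ((A.overlapDual 𝒰 D i j).baseChange
          (pullback.fst (pullback.fst (𝒰.f i) (𝒰.f j)) (pullback.fst (𝒰.f i) (𝒰.f k)))) hG ≫
      pullback.fst (A.overlapDual 𝒰 D j k).hat.X.hom
          (pullback.fst (pullback.fst (𝒰.f j) (𝒰.f k)) (pullback.fst (𝒰.f j) (𝒰.f i))) ≫
        pullback.fst (A.chartDual 𝒰 D j).hat.X.hom (pullback.fst (𝒰.f j) (𝒰.f k)) =
      (pullback.fst (A.overlapDual 𝒰 D i j).hat.X.hom
          (pullback.fst (pullback.fst (𝒰.f i) (𝒰.f j)) (pullback.fst (𝒰.f i) (𝒰.f k))) ≫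
        A.hatTransition 𝒰 D i j) ≫
        pullback.fst (A.chartDual 𝒰 D j).hat.X.hom (pullback.fst (𝒰.f j) (𝒰.f i)) := by
  -- the left-hand side is the dual transport along the composite square into `Aⱼ`
  have lhs : DualPair.hatTransportOfBaseChange
        ((A.overlapDual 𝒰 D j k).baseChange
          (pullback.fst (pullback.fst (𝒰.f j) (𝒰.f k)) (pullback.fst (𝒰.f j) (𝒰.f i))))
        ((A.overlapDual 𝒰 D i j).baseChange
          (pullback.fst (pullback.fst (𝒰.f i) (𝒰.f j)) (pullback.fst (𝒰.f i) (𝒰.f k)))) hG ≫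
      pullback.fst (A.overlapDual 𝒰 D j k).hat.X.hom
          (pullback.fst (pullback.fst (𝒰.f j) (𝒰.f k)) (pullback.fst (𝒰.f j) (𝒰.f i))) ≫
        pullback.fst (A.chartDual 𝒰 D j).hat.X.hom (pullback.fst (𝒰.f j) (𝒰.f k)) =
      DualPair.hatTransportOfBaseChange (A.chartDual 𝒰 D j)
        ((A.overlapDual 𝒰 D i j).baseChange
          (pullback.fst (pullback.fst (𝒰.f i) (𝒰.f j)) (pullback.fst (𝒰.f i) (𝒰.f k))))
        (hG.trans (((A.overlapFamily 𝒰 j k).baseChange_isBaseChangeVia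
          (pullback.fst (pullback.fst (𝒰.f j) (𝒰.f k)) (pullback.fst (𝒰.f j) (𝒰.f i)))).trans
            ((A.baseChange (𝒰.f j)).baseChange_isBaseChangeVia (pullback.fst (𝒰.f j) (𝒰.f k))))) := by
    rw [DualPair.hatTransportOfBaseChange_trans (A.chartDual 𝒰 D j)
        ((A.overlapDual 𝒰 D j k).baseChange
          (pullback.fst (pullback.fst (𝒰.f j) (𝒰.f k)) (pullback.fst (𝒰.f j) (𝒰.f i))))
        ((A.overlapDual 𝒰 D i j).baseChange
          (pullback.fst (pullback.fst (𝒰.f i) (𝒰.f j)) (pullback.fst (𝒰.f i) (𝒰.f k))))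
        (((A.overlapFamily 𝒰 j k).baseChange_isBaseChangeVia
          (pullback.fst (pullback.fst (𝒰.f j) (𝒰.f k)) (pullback.fst (𝒰.f j) (𝒰.f i)))).trans
            ((A.baseChange (𝒰.f j)).baseChange_isBaseChangeVia (pullback.fst (𝒰.f j) (𝒰.f k)))) hG,
      DualPair.hatTransportOfBaseChange_trans (A.chartDual 𝒰 D j) (A.overlapDual 𝒰 D j k)
        ((A.overlapDual 𝒰 D j k).baseChange
          (pullback.fst (pullback.fst (𝒰.f j) (𝒰.f k)) (pullback.fst (𝒰.f j) (𝒰.f i))))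
        ((A.baseChange (𝒰.f j)).baseChange_isBaseChangeVia (pullback.fst (𝒰.f j) (𝒰.f k)))
        ((A.overlapFamily 𝒰 j k).baseChange_isBaseChangeVia
          (pullback.fst (pullback.fst (𝒰.f j) (𝒰.f k)) (pullback.fst (𝒰.f j) (𝒰.f i)))),
      DualPair.hatTransportOfBaseChange_baseChange, DualPair.hatTransportOfBaseChange_baseChange]
  -- the right-hand side is the dual transport along the composite square through `θᵢⱼ`
  have rhs : (pullback.fst (A.overlapDual 𝒰 D i j).hat.X.hom
          (pullback.fst (pullback.fst (𝒰.f i) (𝒰.f j)) (pullback.fst (𝒰.f i) (𝒰.f k))) ≫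
        A.hatTransition 𝒰 D i j) ≫
        pullback.fst (A.chartDual 𝒰 D j).hat.X.hom (pullback.fst (𝒰.f j) (𝒰.f i)) =
      DualPair.hatTransportOfBaseChange (A.chartDual 𝒰 D j)
        ((A.overlapDual 𝒰 D i j).baseChange
          (pullback.fst (pullback.fst (𝒰.f i) (𝒰.f j)) (pullback.fst (𝒰.f i) (𝒰.f k))))
        ((((A.overlapFamily 𝒰 i j).baseChange_isBaseChangeVia
          (pullback.fst (pullback.fst (𝒰.f i) (𝒰.f j)) (pullback.fst (𝒰.f i) (𝒰.f k)))).trans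
            (A.overlapTransition_isBaseChangeVia 𝒰 i j)).trans
              ((A.baseChange (𝒰.f j)).baseChange_isBaseChangeVia (pullback.fst (𝒰.f j) (𝒰.f i)))) := by
    rw [DualPair.hatTransportOfBaseChange_trans (A.chartDual 𝒰 D j) (A.overlapDual 𝒰 D j i)
        ((A.overlapDual 𝒰 D i j).baseChange
          (pullback.fst (pullback.fst (𝒰.f i) (𝒰.f j)) (pullback.fst (𝒰.f i) (𝒰.f k))))
        ((A.baseChange (𝒰.f j)).baseChange_isBaseChangeVia (pullback.fst (𝒰.f j) (𝒰.f i)))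
        (((A.overlapFamily 𝒰 i j).baseChange_isBaseChangeVia
          (pullback.fst (pullback.fst (𝒰.f i) (𝒰.f j)) (pullback.fst (𝒰.f i) (𝒰.f k)))).trans
            (A.overlapTransition_isBaseChangeVia 𝒰 i j)),
      DualPair.hatTransportOfBaseChange_trans (A.overlapDual 𝒰 D j i) (A.overlapDual 𝒰 D i j)
        ((A.overlapDual 𝒰 D i j).baseChange
          (pullback.fst (pullback.fst (𝒰.f i) (𝒰.f j)) (pullback.fst (𝒰.f i) (𝒰.f k))))
        (A.overlapTransition_isBaseChangeVia 𝒰 i j)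
        ((A.overlapFamily 𝒰 i j).baseChange_isBaseChangeVia
          (pullback.fst (pullback.fst (𝒰.f i) (𝒰.f j)) (pullback.fst (𝒰.f i) (𝒰.f k)))),
      DualPair.hatTransportOfBaseChange_baseChange, DualPair.hatTransportOfBaseChange_baseChange]
    rfl
  refine lhs.trans ((DualPair.hatTransportOfBaseChange_congr _ _ _ ?_ ?_ _).trans rhs.symm)
  · rw [Category.assoc, pullbackSymmetry_hom_comp_fst, Scheme.Cover.gluedCoverT'_fst_fst]
  · exact (Category.assoc _ _ _).symm.trans hGfst

/-! ### §3 The dual transports along a cocycle of transitions compose to the identity -/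

omit [IsLocallyNoetherian S] in
/-- **`Ĝ₁ ≫ Ĝ₂ ≫ Ĝ₃ = 𝟙` for the dual transports along transitions `G₁, G₂, G₃` over `t' i j k`, `t' j k i`, `t' k i j`**:
the composite is the dual transport along the composite square (★ `hatTransportOfBaseChange_trans`), whose base map is
`t' ≫ t' ≫ t' = 𝟙` (Mathlib `Scheme.Cover.glued_cover_cocycle`) and whose `A`-map `G₁ ≫ G₂ ≫ G₃` is `𝟙` — it is an
endomorphism of `Aᵢ|_{V(i,j)}|` over the base commuting with the projection to `A` (`overlapTransition₃_comp_toA`), and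
such a map is unique (★ `IsBaseChangeVia.comp_eq_unique`) — hence the transport along `(𝟙, 𝟙)`, the identity (★
`hatTransportOfBaseChange_congr`, B-p06's `hatTransportOfBaseChange_refl_eq_id`).  [MilneAV2008, I §8]: transition
isomorphisms of dual pairs are UNIQUE, so they satisfy the cocycle condition. [cite: MilneAV2008, I §8 pp. 36–37]
[cite: MumfordFogartyKirwan1994, Ch. 6 §1 Cor. 6.8 (p. 118)] [cite: StacksProject, Tag 01LH] -/
theorem hatTransport₃_cocycle (i j k : 𝒰.I₀)
    (G₁ : ((A.overlapFamily 𝒰 i j).baseChange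
        (pullback.fst (pullback.fst (𝒰.f i) (𝒰.f j)) (pullback.fst (𝒰.f i) (𝒰.f k)))).X.left ⟶
      ((A.overlapFamily 𝒰 j k).baseChange
        (pullback.fst (pullback.fst (𝒰.f j) (𝒰.f k)) (pullback.fst (𝒰.f j) (𝒰.f i)))).X.left)
    (G₂ : ((A.overlapFamily 𝒰 j k).baseChange
        (pullback.fst (pullback.fst (𝒰.f j) (𝒰.f k)) (pullback.fst (𝒰.f j) (𝒰.f i)))).X.left ⟶
      ((A.overlapFamily 𝒰 k i).baseChange
        (pullback.fst (pullback.fst (𝒰.f k) (𝒰.f i)) (pullback.fst (𝒰.f k) (𝒰.f j)))).X.left)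
    (G₃ : ((A.overlapFamily 𝒰 k i).baseChange
        (pullback.fst (pullback.fst (𝒰.f k) (𝒰.f i)) (pullback.fst (𝒰.f k) (𝒰.f j)))).X.left ⟶
      ((A.overlapFamily 𝒰 i j).baseChange
        (pullback.fst (pullback.fst (𝒰.f i) (𝒰.f j)) (pullback.fst (𝒰.f i) (𝒰.f k)))).X.left)
    (hG₁ : ((A.overlapFamily 𝒰 i j).baseChange
        (pullback.fst (pullback.fst (𝒰.f i) (𝒰.f j)) (pullback.fst (𝒰.f i) (𝒰.f k)))).IsBaseChangeVia
      ((A.overlapFamily 𝒰 j k).baseChange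
        (pullback.fst (pullback.fst (𝒰.f j) (𝒰.f k)) (pullback.fst (𝒰.f j) (𝒰.f i))))
      (𝒰.gluedCoverT' i j k) G₁)
    (hG₂ : ((A.overlapFamily 𝒰 j k).baseChange
        (pullback.fst (pullback.fst (𝒰.f j) (𝒰.f k)) (pullback.fst (𝒰.f j) (𝒰.f i)))).IsBaseChangeVia
      ((A.overlapFamily 𝒰 k i).baseChange
        (pullback.fst (pullback.fst (𝒰.f k) (𝒰.f i)) (pullback.fst (𝒰.f k) (𝒰.f j))))
      (𝒰.gluedCoverT' j k i) G₂)
    (hG₃ : ((A.overlapFamily 𝒰 k i).baseChange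
        (pullback.fst (pullback.fst (𝒰.f k) (𝒰.f i)) (pullback.fst (𝒰.f k) (𝒰.f j)))).IsBaseChangeVia
      ((A.overlapFamily 𝒰 i j).baseChange
        (pullback.fst (pullback.fst (𝒰.f i) (𝒰.f j)) (pullback.fst (𝒰.f i) (𝒰.f k))))
      (𝒰.gluedCoverT' k i j) G₃)
    (h₁ : G₁ ≫ pullback.fst (A.overlapFamily 𝒰 j k).X.hom
            (pullback.fst (pullback.fst (𝒰.f j) (𝒰.f k)) (pullback.fst (𝒰.f j) (𝒰.f i))) ≫
          pullback.fst (A.baseChange (𝒰.f j)).X.hom (pullback.fst (𝒰.f j) (𝒰.f k)) =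
      (pullback.fst (A.overlapFamily 𝒰 i j).X.hom
            (pullback.fst (pullback.fst (𝒰.f i) (𝒰.f j)) (pullback.fst (𝒰.f i) (𝒰.f k))) ≫
          A.overlapTransition 𝒰 i j) ≫
        pullback.fst (A.baseChange (𝒰.f j)).X.hom (pullback.fst (𝒰.f j) (𝒰.f i)))
    (h₂ : G₂ ≫ pullback.fst (A.overlapFamily 𝒰 k i).X.hom
            (pullback.fst (pullback.fst (𝒰.f k) (𝒰.f i)) (pullback.fst (𝒰.f k) (𝒰.f j))) ≫
          pullback.fst (A.baseChange (𝒰.f k)).X.hom (pullback.fst (𝒰.f k) (𝒰.f i)) =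
      (pullback.fst (A.overlapFamily 𝒰 j k).X.hom
            (pullback.fst (pullback.fst (𝒰.f j) (𝒰.f k)) (pullback.fst (𝒰.f j) (𝒰.f i))) ≫
          A.overlapTransition 𝒰 j k) ≫
        pullback.fst (A.baseChange (𝒰.f k)).X.hom (pullback.fst (𝒰.f k) (𝒰.f j)))
    (h₃ : G₃ ≫ pullback.fst (A.overlapFamily 𝒰 i j).X.hom
            (pullback.fst (pullback.fst (𝒰.f i) (𝒰.f j)) (pullback.fst (𝒰.f i) (𝒰.f k))) ≫
          pullback.fst (A.baseChange (𝒰.f i)).X.hom (pullback.fst (𝒰.f i) (𝒰.f j)) =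
      (pullback.fst (A.overlapFamily 𝒰 k i).X.hom
            (pullback.fst (pullback.fst (𝒰.f k) (𝒰.f i)) (pullback.fst (𝒰.f k) (𝒰.f j))) ≫
          A.overlapTransition 𝒰 k i) ≫
        pullback.fst (A.baseChange (𝒰.f i)).X.hom (pullback.fst (𝒰.f i) (𝒰.f k))) :
    DualPair.hatTransportOfBaseChange
        ((A.overlapDual 𝒰 D j k).baseChange
          (pullback.fst (pullback.fst (𝒰.f j) (𝒰.f k)) (pullback.fst (𝒰.f j) (𝒰.f i))))
        ((A.overlapDual 𝒰 D i j).baseChange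
          (pullback.fst (pullback.fst (𝒰.f i) (𝒰.f j)) (pullback.fst (𝒰.f i) (𝒰.f k)))) hG₁ ≫
      DualPair.hatTransportOfBaseChange
        ((A.overlapDual 𝒰 D k i).baseChange
          (pullback.fst (pullback.fst (𝒰.f k) (𝒰.f i)) (pullback.fst (𝒰.f k) (𝒰.f j))))
        ((A.overlapDual 𝒰 D j k).baseChange
          (pullback.fst (pullback.fst (𝒰.f j) (𝒰.f k)) (pullback.fst (𝒰.f j) (𝒰.f i)))) hG₂ ≫
      DualPair.hatTransportOfBaseChange
        ((A.overlapDual 𝒰 D i j).baseChange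
          (pullback.fst (pullback.fst (𝒰.f i) (𝒰.f j)) (pullback.fst (𝒰.f i) (𝒰.f k))))
        ((A.overlapDual 𝒰 D k i).baseChange
          (pullback.fst (pullback.fst (𝒰.f k) (𝒰.f i)) (pullback.fst (𝒰.f k) (𝒰.f j)))) hG₃ = 𝟙 _ := by
  rw [← DualPair.hatTransportOfBaseChange_trans, ← DualPair.hatTransportOfBaseChange_trans]
  -- the `A`-maps compose to the identity: an endomorphism over the base commuting with the projection to `A`
  have hA : G₁ ≫ G₂ ≫ G₃ = 𝟙 _ := by
    have href := ((A.overlapFamily 𝒰 i j).baseChange_isBaseChangeVia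
      (pullback.fst (pullback.fst (𝒰.f i) (𝒰.f j)) (pullback.fst (𝒰.f i) (𝒰.f k)))).trans
        (A.overlapFamily_isBaseChangeVia 𝒰 i j)
    refine IsBaseChangeVia.comp_eq_unique (t := 𝟙 _) href ?_ ?_ (Category.id_comp _)
      (by rw [Category.id_comp, Category.comp_id])
    · exact (Category.assoc _ _ _).trans ((congrArg (G₁ ≫ ·) ((Category.assoc _ _ _).trans
        ((congrArg (G₂ ≫ ·) (A.overlapTransition₃_comp_toA 𝒰 k i j G₃ h₃)).trans
          (A.overlapTransition₃_comp_toA 𝒰 j k i G₂ h₂)))).trans (A.overlapTransition₃_comp_toA 𝒰 i j k G₁ h₁))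
    · rw [Category.comp_id, Category.assoc, Category.assoc, hG₃.fst, reassoc_of% hG₂.fst, reassoc_of% hG₁.fst,
        Scheme.Cover.glued_cover_cocycle, Category.comp_id]
  rw [DualPair.hatTransportOfBaseChange_congr _ _ _ (Scheme.Cover.glued_cover_cocycle 𝒰 i j k) hA
    (IsBaseChangeVia.refl _)]
  exact hatTransportOfBaseChange_refl_eq_id _

/-! ### §4 The cocycle identity of the hat transitions, and the glued hat over `S` -/

/-- **THE COCYCLE IDENTITY OF THE HAT TRANSITIONS** `θᵢⱼ = hatTransition i j` on the relative triple overlaps, in ★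
B-p04's `relativeT'` currency and in EXACTLY the binder shape of ★ `hatCocycleDatum` / `gluedHat` (B-p06): §1
`relativeT'_cocycle_of_transitions` fed with the dual transports of §2 (their `Âⱼ`-components by `hatTransport₃_fst_fst`,
their base maps by ★ `hatTransportOfBaseChange_comp_hom`) and §3 `hatTransport₃_cocycle`.  [MilneAV2008, I §8] /
[BoschLutkebohmertRaynaud1990, §8.1]: the transition isomorphisms of the chartwise duals are unique, hence a cocycle.
[cite: MilneAV2008, I §8 pp. 36–37] [cite: BoschLutkebohmertRaynaud1990, §8.1 Prop. 4 (pp. 204–205)] [cite: StacksProject, Tag 01LH] -/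
theorem hatTransition_cocycle (i j k : 𝒰.I₀) :
    Morphisms.relativeT' 𝒰.gluedCover (fun i => (A.chartDual 𝒰 D i).hat.X.left) (fun i => (A.chartDual 𝒰 D i).hat.X.hom)
        (A.hatTransition 𝒰 D) (fun i j => (A.hatTransition_isBaseChangeVia 𝒰 D i j).fst) i j k ≫
      Morphisms.relativeT' 𝒰.gluedCover (fun i => (A.chartDual 𝒰 D i).hat.X.left) (fun i => (A.chartDual 𝒰 D i).hat.X.hom)
        (A.hatTransition 𝒰 D) (fun i j => (A.hatTransition_isBaseChangeVia 𝒰 D i j).fst) j k i ≫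
      Morphisms.relativeT' 𝒰.gluedCover (fun i => (A.chartDual 𝒰 D i).hat.X.left) (fun i => (A.chartDual 𝒰 D i).hat.X.hom)
        (A.hatTransition 𝒰 D) (fun i j => (A.hatTransition_isBaseChangeVia 𝒰 D i j).fst) k i j = 𝟙 _ := by
  choose G hG hGfst using fun a b c => A.exists_overlapTransition₃ 𝒰 a b c
  exact relativeT'_cocycle_of_transitions 𝒰.gluedCover (fun i => (A.chartDual 𝒰 D i).hat.X.left)
    (fun i => (A.chartDual 𝒰 D i).hat.X.hom) (A.hatTransition 𝒰 D)
    (fun i j => (A.hatTransition_isBaseChangeVia 𝒰 D i j).fst)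
    (fun a b c => DualPair.hatTransportOfBaseChange
      ((A.overlapDual 𝒰 D b c).baseChange
        (pullback.fst (pullback.fst (𝒰.f b) (𝒰.f c)) (pullback.fst (𝒰.f b) (𝒰.f a))))
      ((A.overlapDual 𝒰 D a b).baseChange
        (pullback.fst (pullback.fst (𝒰.f a) (𝒰.f b)) (pullback.fst (𝒰.f a) (𝒰.f c)))) (hG a b c))
    (fun a b c => A.hatTransport₃_fst_fst 𝒰 D a b c (G a b c) (hG a b c) (hGfst a b c))
    (fun a b c => DualPair.hatTransportOfBaseChange_comp_hom _ _ (hG a b c))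
    (fun a b c => A.hatTransport₃_cocycle 𝒰 D a b c (G a b c) (G b c a) (G c a b) (hG a b c) (hG b c a) (hG c a b)
      (hGfst a b c) (hGfst b c a) (hGfst c a b)) i j k

/-- **THE GLUED HAT OVER `S` (head for the Poincaré-sheaf gluing, FILE P)**: for an abelian scheme `A → S` over a locally
Noetherian base, an open cover `𝒰 = (Uᵢ → S)` and a dual pair `Dᵢ` of every `A ×_S Uᵢ`, there is an abelian scheme `Â⁰ → S`
with charts `χᵢ : Âᵢ → Â⁰` exhibiting every (hat-normalised, same `Âᵢ`) chart dual `Âᵢ` as the base change of `Â⁰` along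
`Uᵢ → S` AS A GROUP SCHEME, and satisfying the glue condition `θᵢⱼ ≫ pr ≫ χⱼ = pr ≫ χᵢ` over `V(i,j)` for B-p06's hat
transitions `θᵢⱼ` — ★ `gluedHat` with its `hcoc` hypothesis discharged by `hatTransition_cocycle`, transported from Mathlib's
`𝒰.gluedCover.glued` to `S` along the isomorphism `𝒰.fromGlued` (★ `exists_comp_eq_of_comp` / `isBaseChangeVia_of_comp`;
glue condition = Mathlib `Scheme.GlueData.glue_condition` of the glued total space). [cite: MumfordFogartyKirwan1994, Ch. 6 §1 Cor. 6.8 (p. 118)]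
[cite: BoschLutkebohmertRaynaud1990, §8.1 Prop. 4 (pp. 204–205)] [cite: StacksProject, Tag 01LH] [cite: MilneAV2008, I §8 pp. 36–37] -/
theorem exists_gluedHat :
    ∃ (H : AbelianSchemeOver S) (χ : ∀ i, (A.chartDual 𝒰 D i).hat.X.left ⟶ H.X.left),
      (∀ i, (A.chartDual 𝒰 D i).hat.IsBaseChangeVia H (𝒰.f i) (χ i)) ∧
      ∀ i j, A.hatTransition 𝒰 D i j ≫
          pullback.fst (A.chartDual 𝒰 D j).hat.X.hom (pullback.fst (𝒰.f j) (𝒰.f i)) ≫ χ j =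
        pullback.fst (A.chartDual 𝒰 D i).hat.X.hom (pullback.fst (𝒰.f i) (𝒰.f j)) ≫ χ i := by
  let 𝔊 := A.hatCocycleDatum 𝒰 D (A.hatTransition_cocycle 𝒰 D)
  -- the charts of the glued hat over `𝒰.gluedCover.glued`, transported to `S` along `fromGlued`
  have hι : ∀ i : 𝒰.I₀, 𝒰.gluedCover.ι i = 𝒰.f i ≫ inv 𝒰.fromGlued :=
    fun i => (IsIso.eq_comp_inv 𝒰.fromGlued).mpr (Scheme.Cover.ι_fromGlued 𝒰 i)
  have h₁ : ∀ i : 𝒰.I₀, (A.chartDual 𝒰 D i).hat.IsBaseChangeVia 𝔊.abelianScheme (𝒰.f i ≫ inv 𝒰.fromGlued)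
      (𝔊.total.ι i) :=
    fun i => IsBaseChangeVia.congr_base (hι i) (𝔊.isBaseChangeVia_abelianScheme i)
  have h₂ := 𝔊.abelianScheme.baseChange_isBaseChangeVia (inv 𝒰.fromGlued)
  choose χ hχ hχπ using fun i => IsBaseChangeVia.exists_comp_eq_of_comp (h₁ i) h₂
  refine ⟨𝔊.abelianScheme.baseChange (inv 𝒰.fromGlued), χ,
    fun i => isBaseChangeVia_of_comp (h₁ i) h₂ (χ i) (hχ i) (hχπ i), fun i j => ?_⟩
  refine (cancel_mono (pullback.fst 𝔊.abelianScheme.X.hom (inv 𝒰.fromGlued))).1 ?_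
  -- after the projection to the glued total space: the glue condition `θᵢⱼ ≫ pr ≫ ιⱼ = pr ≫ ιᵢ` of `𝔊.total`
  exact (Category.assoc _ _ _).trans ((congrArg (A.hatTransition 𝒰 D i j ≫ ·) ((Category.assoc _ _ _).trans
    (congrArg (pullback.fst (A.chartDual 𝒰 D j).hat.X.hom (pullback.fst (𝒰.f j) (𝒰.f i)) ≫ ·) (hχ j)))).trans
      ((𝔊.total.glue_condition i j).trans ((congrArg
        (pullback.fst (A.chartDual 𝒰 D i).hat.X.hom (pullback.fst (𝒰.f i) (𝒰.f j)) ≫ ·) (hχ i)).symm.trans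
          (Category.assoc _ _ _).symm)))

end Hat

end AbelianSchemeOver

end Literature.AlgebraicGeometry.AbelianSchemes

end
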